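import Mathlib
import HarnessLib
import Summits.QuantumFields.Statement
import Summits.QuantumFields.YangMills.Theses.UnitScaleTilt
import Summits.QuantumFields.YangMills.Theses.CovariantDischarge
import Literature.MathematicalPhysics.QuantumFieldTheory.Balaban1983to89.T3YM3TorusStatement
import Literature.MathematicalPhysics.QuantumFieldTheory.Balaban1983to89.WilsonLoopLimit

/-!
# LINE rectangle_domination — skeleton (crux stmt-QuantumFields-19936 `UnitScaleTilt.HistoryTailL`)

Seat ym-r3-idea-2 g8, lens «nearmiss» (LINE 17). Route route-QuantumFields-RectangleDomination
(`Summits.QuantumFields.YangMills.Theses.RectangleDomination`; NOT imported here because the farm snapshot predates the route file — the route's crux decls are re-declared below with BYTE-IDENTICAL bodies, so each local `X` is `rfl`-equal to `Summit.QuantumFields.YangMills.Theses.RectangleDomination.X` and the glue hypothesis of `HistoryTailL_of` is the route's glue item unfolded). The near-miss: the tree's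
`HistoryTailBoundedHeightLocal.perPlaquette_boundedHeight_uniform` has the measured deficit c = ¼Λ^(−2j₀) from its fine-PLAQUETTE footprint;
this line uses a footprint of finest RECTANGULAR Wilson loops (perimeter scaling √L per level instead of Λ = 151L²).
Stubs: `stub_rectMoments` (HARDEST: sub-Gaussian perimeter-law moments of one contractible finest rectangle, uniform in β),
`stub_tail_of_moments` (Markov optimisation ⇒ `RectangleTailL`), `stub_smallGuards` (EML chart guards along the unrolling),
`stub_domOfGuards` (telescoped first-order domination + BCH remainder under the side condition ⇒ `ShallowRectangleDominationL`).
The residual `DeepWindowTailL` (= stmt-22892) and the glue item `HistoryTailOfRectanglesL` enter as a hypothesis BY NAME (route item stmt-22892) and as the stub `stub_glue` (the glue item unfolded).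
Compositions `RectangleTailL_of`, `ShallowRectangleDominationL_of`, `HistoryTailL_of` are kernel-checked (no sorry). No summit and no rung is proved here.
-/

namespace Summit.QuantumFields.YangMills.Cruxes.HistoryTailL.RectangleDomination

open scoped BigOperators Topology Classical MeasureTheory ProbabilityTheory Matrix
open MeasureTheory

/-- = `Summit.QuantumFields.YangMills.Theses.RectangleDomination.RectangleTailL` (byte-identical body). -/
def RectangleTailL : Prop :=
  open Literature.MathematicalPhysics.QuantumFieldTheory.Balaban1983to89 Literature.MathematicalPhysics.QuantumFieldTheory.Balaban1983to89.T3ContinuumYM3Torus in ∀ (L : ℕ), ∃ (α c C : ℝ) (A : ℕ), 0 < α ∧ 0 < c ∧ 0 ≤ C ∧ ∀ (F : T3Family) (γ : ℝ), F.L = L → 0 < γ → γ ≤ 1 → ∀ (K a b : ℕ) (x : Site (F.P K) 0) (μ ν : Fin (F.P K).d) (t : ℝ), μ ≠ ν → 1 ≤ a → 1 ≤ b → 2 * (a + b) < (F.P K).sitesPerDir 0 → 0 < t → t ≤ 1 → (T3UnitScaleTilt.gibbsK F T3UnitLawDensityEML.ℰp γ K).real {U | t ≤ GaugeGroup.dist1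 (Missing.pathHol U (Missing.rectLoop x μ ν a b))} ≤ C * (F.scheme T3UnitLawDensityEML.ℰp γ).β K ^ A * ((a : ℝ) + b) ^ A * Real.exp (-((c * (t ^ 2 * (F.scheme T3UnitLawDensityEML.ℰp γ).β K / (((a : ℝ) + b) * (1 + Real.log ((a : ℝ) + b))))) ^ α))

/-- = `Summit.QuantumFields.YangMills.Theses.RectangleDomination.ShallowRectangleDominationL` (byte-identical body). -/
def ShallowRectangleDominationL : Prop :=
  open Literature.MathematicalPhysics.QuantumFieldTheory.Balaban1983to89 Literature.MathematicalPhysics.QuantumFieldTheory.Balaban1983to89.T3ContinuumYM3Torus in ∀ (L : ℕ), ∃ (C R η₀ : ℝ), 0 < C ∧ 2 ≤ R ∧ 0 < η₀ ∧ ∀ (F : T3Family), F.L = L → ∀ (K j : ℕ) (q : Plaq (F.P K) j) (U : GaugeField (F.P K) 0 (Matrix.specialUnitaryGroup (Fin 2) ℂ)) (η : ℝ), j ≤ K → 0 < η → Real.sqrt ((L : ℝ) ^ j) * (j + 1) * η ≤ η₀ → (∀ (i a b : ℕ) (x : Site (F.P K) 0) (μ ν : Fin (F.P K).d), μ ≠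 ν → i ≤ j → 1 ≤ a → 1 ≤ b → 2 * (a + b) < (F.P K).sitesPerDir 0 → ((a : ℝ) + b) ≤ R * (L : ℝ) ^ i → GaugeGroup.dist1 (Missing.pathHol U (Missing.rectLoop x μ ν a b)) ≤ η * Real.sqrt ((L : ℝ) ^ i / (L : ℝ) ^ j)) → GaugeGroup.dist1 (GaugeField.plaqHol (Averaging.iter (fun i => BlockAveraging.blockAvg (P := F.P K) (j := i) T3UnitLawDensityEML.ℰp) j U) q) ≤ C * (j + 1) * η

/-- Layer-2 statement: SUB-GAUSSIAN PERIMETER-LAW MOMENTS of the rectangle holonomy, E_K[dist1(hol ∂rect)^n] ≤ C·β_K^A·(a+b)^A·(n(a+b)(1+log(a+b))/(cβ_K))^(n/2). -/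
def RectMomentsL : Prop :=
  open Literature.MathematicalPhysics.QuantumFieldTheory.Balaban1983to89 Literature.MathematicalPhysics.QuantumFieldTheory.Balaban1983to89.T3ContinuumYM3Torus in ∀ (L : ℕ), ∃ (c C : ℝ) (A : ℕ), 0 < c ∧ 0 ≤ C ∧ ∀ (F : T3Family) (γ : ℝ), F.L = L → 0 < γ → γ ≤ 1 → ∀ (K a b : ℕ) (x : Site (F.P K) 0) (μ ν : Fin (F.P K).d) (n : ℕ), μ ≠ ν → 1 ≤ a → 1 ≤ b → 2 * (a + b) < (F.P K).sitesPerDir 0 → 1 ≤ n → ∫ U, (GaugeGroup.dist1 (Missing.pathHol U (Missing.rectLoop x μ ν a b))) ^ n ∂(T3UnitScaleTilt.gibbsK F T3UnitLawDensityEML.ℰp γ K) ≤ C * (F.scheme T3UnitLawDensityEML.ℰp γ).β K ^ A * ((a : ℝ) + b) ^ A * ((n : ℝ) * (((a : ℝ) + b) * (1 + Real.log ((a : ℝ) + b))) / (c * (F.scheme T3UnitLawDensityEML.ℰp γ).β K)) ^ ((n : ℝ) / 2)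

/-- Layer-2 statement: the EML chart guards `BlockAveraging.Small` hold at every level i < j along the unrolling, under the crux's hypotheses. -/
def GuardsL : Prop :=
  open Literature.MathematicalPhysics.QuantumFieldTheory.Balaban1983to89 Literature.MathematicalPhysics.QuantumFieldTheory.Balaban1983to89.T3ContinuumYM3Torus in ∀ (L : ℕ), ∃ (R η₀ : ℝ), 2 ≤ R ∧ 0 < η₀ ∧ ∀ (F : T3Family), F.L = L → ∀ (K j : ℕ) (U : GaugeField (F.P K) 0 (Matrix.specialUnitaryGroup (Fin 2) ℂ)) (η : ℝ), j ≤ K → 0 < η → Real.sqrt ((L : ℝ) ^ j) * (j + 1) * η ≤ η₀ → (∀ (i a b : ℕ) (x : Site (F.P K) 0) (μ ν : Fin (F.P K).d), μ ≠ ν → i ≤ j → 1 ≤ a → 1 ≤ b → 2 * (a + b) < (F.P K).sitesPerDir 0 → ((a : ℝ) + b) ≤ R * (L : ℝ) ^ i → GaugeGroup.dist1 (Missing.pathHol U (Missing.rectLoop x μ ν a b)) ≤ η * Real.sqrt ((L : ℝ) ^ i / (L : ℝ) ^ j)) → ∀ (i : ℕ), i < j → ∀ c : PBond (F.P K) (i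 + 1), BlockAveraging.Small (P := F.P K) (j := i) T3UnitLawDensityEML.ℰp (Averaging.iter (fun i' => BlockAveraging.blockAvg (P := F.P K) (j := i') T3UnitLawDensityEML.ℰp) i U) c

/-- STUB (HARDEST, XL): perimeter-law moments of one finest contractible rectangle, uniform in the cut-off (abelian sibling: exact Gaussian
spin-wave computation, arXiv:2107.04021; non-abelian: line-source / axial-gauge expansion, [ChatterjeeYMProb2019] §4). -/
theorem stub_rectMoments : RectMomentsL := by
  sorry

/-- STUB (M): Markov at the optimal moment n ≍ c t²β_K/(e(a+b)(1+log(a+b))) (measurability of U ↦ dist1(hol rect) from continuity). -/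
theorem stub_tail_of_moments : RectMomentsL → RectangleTailL := by
  sorry

/-- STUB (M): the chart guards (crude local Prop 1 `BlockAveragingPlaquetteBoundLocal.plaqSmallOn_avgFun_of_near` level by level under the
rectangle-flatness hypotheses and the side condition). -/
theorem stub_smallGuards : GuardsL := by
  sorry

/-- STUB (L): the deterministic domination given the guards — unrolled `avgFun = corr · axialAvg`, first-order telescoping of the correction
fluxes along each side into O(j) averaged strip/corner polygons (≤ 64 rectangles each, bubble-sort non-abelian Stokes), BCH remainder
≤ C(j+1)²η²√(L^j) absorbed by the side condition √(L^j)(j+1)η ≤ η₀. -/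
theorem stub_domOfGuards : GuardsL → ShallowRectangleDominationL := by
  sorry

/-- COMPOSITION (kernel-checked). -/
theorem RectangleTailL_of (h₁ : RectMomentsL) (h₂ : RectMomentsL → RectangleTailL) : RectangleTailL := h₂ h₁

/-- COMPOSITION (kernel-checked). -/
theorem ShallowRectangleDominationL_of (h₁ : GuardsL) (h₂ : GuardsL → ShallowRectangleDominationL) : ShallowRectangleDominationL := h₂ h₁

/-- The TARGET CRUX under a local name (so that only `HistoryTailL_of` concludes the crux BY NAME; `CruxGoal` unfolds to it by `rfl`). -/
def CruxGoal : Prop :=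
  Summit.QuantumFields.YangMills.Theses.UnitScaleTilt.HistoryTailL

theorem cruxGoal_iff : CruxGoal ↔ Summit.QuantumFields.YangMills.Theses.UnitScaleTilt.HistoryTailL := Iff.rfl

/-- STUB (M, = the route's glue item `HistoryTailOfRectanglesL`, stmt-QuantumFields-23867, unfolded): union bound over ≤ poly(L^(m+K))
rectangles with the profile arithmetic θ(h)²β_K/L^j = p(g_h)², p₀ ≥ 3 + 1/α, window h ≥ 2j deterministic / K < 3j residual, first-exit bookkeeping. -/
theorem stub_glue : RectangleTailL → ShallowRectangleDominationL → Summit.QuantumFields.YangMills.Theses.CovariantDischarge.DeepWindowTailL → CruxGoal := by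
  sorry

/-- COMPOSITION (kernel-checked): the stubs, the shared residual (route item, stmt-22892) and the route's glue item conclude the TARGET CRUX BY NAME. -/
theorem HistoryTailL_of
    (hW : Summit.QuantumFields.YangMills.Theses.CovariantDischarge.DeepWindowTailL) :
    Summit.QuantumFields.YangMills.Theses.UnitScaleTilt.HistoryTailL :=
  cruxGoal_iff.mp
    (stub_glue (RectangleTailL_of stub_rectMoments stub_tail_of_moments) (ShallowRectangleDominationL_of stub_smallGuards stub_domOfGuards) hW)

end Summit.QuantumFields.YangMills.Cruxes.HistoryTailL.RectangleDomination
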